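import Literature.NumberTheory.Automorphic.BrandtTraceEllipticTerms
import Literature.NumberTheory.Automorphic.QuaternionAlgebraEmbeddingHolds
import Mathlib.NumberTheory.Padics.HeightOneSpectrum
import Mathlib.NumberTheory.NumberField.Completion.InfinitePlace
import Mathlib.NumberTheory.NumberField.InfinitePlace.TotallyRealComplex
import HarnessLib

/-!
# The elliptic terms at a non-embeddable `(t, n)`: `Σ_f h_w (∏ m_q) m_p = 0`

Topic `NumberTheory/Automorphic`; theorems only (no named fact, no `sorry`).  Sixteenth brick of
the Brandt-module side of the Eichler–Pizer trace identity: for a Brandt setup `S` of level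
`(M, p)` and `t² < 4n`, if **no** element of `D` has reduced trace `t` and reduced norm `n`
(i.e. `ℚ(√(t² - 4n))` does not embed in `D`, i.e. `p` splits in it), then every Brandt local
embedding number `m_p(f)` at the ramified prime vanishes, so that
`Σ_f h_w((t² - 4n)/f²) (∏_{q ∈ P} m_q(f)) m_p(f) = 0` (`XiSetup.sum_hw_br_eq_zero_of_forall`).
Ingredients: Vignéras' embedding theorem III.3.8 (`exists_sq_eq_of_not_isSquare_ramified_holds`:
`ℚ(√Δ) ↪ D` as soon as `Δ` is not a square in `ℚ_p` and `Δ < 0`), the dictionary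
`ℚ_v ≃ ℚ_[p]` (`Rat.HeightOneSpectrum.adicCompletion.padicEquiv`), and a Hensel-type count:
if `t'² - 4n'` is a `p`-adic square and `ℤ[σ]` (`σ² = t'σ - n'`) is maximal at `p` then
`x² - t'x + n'` has two roots modulo `p` (`rho_eq_two_of_isSquare_padic`).

## References

* M.-F. Vignéras, *Arithmétique des algèbres de quaternions*, LNM 800 (1980), Ch. III §3
  Thm. 3.8; Ch. II §3 (m_p = 1 - (L/p)), [VignerasLNM800].
-/

noncomputable section

open Finset

universe u

namespace Literature.NumberTheory.Automorphic

open HeckeTraceFormulaGL2Level NumberField IsDedekindDomain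

namespace Brandt

/-! ### A Hensel-type count -/

section Hensel

variable {q : ℕ} [hq : Fact q.Prime]

omit hq in
/-- Divisibility `q ∣ x² - t'x + n'` only depends on `x mod q`. [folklore] -/
theorem dvd_quad_of_dvd_sub {t' n' x y : ℤ} (hxy : (q : ℤ) ∣ x - y) (hy : (q : ℤ) ∣ y ^ 2 - t' * y + n') :
    (q : ℤ) ∣ x ^ 2 - t' * x + n' := by
  have e : x ^ 2 - t' * x + n' = (y ^ 2 - t' * y + n') + (x - y) * (x + y - t') := by ring
  rw [e]; exact dvd_add hy (hxy.mul_right _)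

/-- A natural number `a` with `q ∣ a² - t'a + n'` contributes a root `a mod q` to `ρ_q`. [folklore] -/
theorem mod_mem_filter_of_dvd {t' n' : ℤ} {a : ℕ} (ha : (q : ℤ) ∣ (a : ℤ) ^ 2 - t' * a + n') :
    a % q ∈ (Finset.range q).filter fun x : ℕ => (q : ℤ) ∣ (x : ℤ) ^ 2 - t' * x + n' := by
  rw [Finset.mem_filter, Finset.mem_range]
  refine ⟨Nat.mod_lt _ hq.out.pos, dvd_quad_of_dvd_sub ?_ ha⟩
  rw [Int.natCast_mod, Int.emod_def]
  exact ⟨-((a : ℤ) / q), by ring⟩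

/-- **Integrality of the roots**: if `α + β ∈ ℤ_q`-ish (`‖α + β‖ ≤ 1`) and `‖α β‖ ≤ 1` then
`‖α‖ ≤ 1`. [folklore] -/
theorem norm_le_one_of_sum_prod {α β : ℚ_[q]} (hs : ‖α + β‖ ≤ 1) (hp : ‖α * β‖ ≤ 1) : ‖α‖ ≤ 1 := by
  by_contra hα
  push Not at hα
  have hα0 : 0 < ‖α‖ := lt_trans zero_lt_one hα
  have hβ : ‖β‖ < 1 := by
    rw [norm_mul] at hp
    by_contra hβ; push Not at hβ
    have : 1 < ‖α‖ * ‖β‖ := by nlinarith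
    linarith
  have hne : ‖α‖ ≠ ‖β‖ := by intro e; rw [e] at hα; linarith
  have := Padic.add_eq_max_of_ne hne
  rw [max_eq_left (by linarith)] at this
  linarith

/-- **Hensel-type count**: if `t'² - 4n'` is a square in `ℚ_q` and `ℤ[σ]` (`σ² = t'σ - n'`) is
maximal at `q`, then `x² - t'x + n'` has exactly two roots modulo `q` (`q` splits in
`ℤ[σ]`). [cite: VignerasLNM800, Ch. II §3 (m_p = 1 - (L/p)); Cox2013, Prop. 5.16 / §7.D] -/
theorem rho_eq_two_of_isSquare_padic {t' n' : ℤ}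
    (hmax : ¬ ∃ k : ℤ, (q : ℤ) ∣ t' + 2 * k ∧ (q : ℤ) ^ 2 ∣ k ^ 2 + t' * k + n')
    (hsq : IsSquare (((t' ^ 2 - 4 * n' : ℤ) : ℚ_[q]))) : rho q t' n' = 2 := by
  have hqR : (1 : ℝ) < q := by exact_mod_cast hq.out.one_lt
  have hq0 : (0 : ℝ) < q := by positivity
  have hqinv1 : (q : ℝ)⁻¹ < 1 := inv_lt_one_of_one_lt₀ hqR
  obtain ⟨s, hs⟩ := hsq
  -- the roots `α, β = (t' ± s)/2`
  obtain ⟨α, hα⟩ : ∃ α : ℚ_[q], α = ((t' : ℚ_[q]) + s) / 2 := ⟨_, rfl⟩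
  obtain ⟨β, hβ⟩ : ∃ β : ℚ_[q], β = ((t' : ℚ_[q]) - s) / 2 := ⟨_, rfl⟩
  have hsum : α + β = t' := by rw [hα, hβ]; ring
  have hprod : α * β = n' := by
    have e : α * β = ((t' : ℚ_[q]) ^ 2 - s * s) / 4 := by rw [hα, hβ]; ring
    rw [e, ← hs]; push_cast; ring
  have hdiff : α - β = s := by rw [hα, hβ]; ring
  have hαint : ‖α‖ ≤ 1 := norm_le_one_of_sum_prod (by rw [hsum]; exact Padic.norm_int_le_one _)
    (by rw [hprod]; exact Padic.norm_int_le_one _)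
  have hβint : ‖β‖ ≤ 1 := norm_le_one_of_sum_prod (by rw [add_comm, hsum]; exact Padic.norm_int_le_one _)
    (by rw [mul_comm, hprod]; exact Padic.norm_int_le_one _)
  have hnat : ∀ c : ℕ, ‖(c : ℚ_[q])‖ ≤ 1 := fun c => by simpa using Padic.norm_int_le_one (p := q) (c : ℤ)
  -- ultrametric estimates for differences
  have hsub : ∀ {x y : ℚ_[q]} {r : ℝ}, ‖x‖ ≤ r → ‖y‖ ≤ r → ‖x - y‖ ≤ r := by
    intro x y r hx hy
    rw [sub_eq_add_neg]
    exact (Padic.nonarchimedean _ _).trans (max_le hx (by rwa [norm_neg]))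
  have hs1 : ‖s‖ ≤ 1 := by rw [← hdiff]; exact hsub hαint hβint
  -- factorisations
  have hfac : ∀ x : ℚ_[q], x ^ 2 - t' * x + n' = (x - α) * (x - β) := by
    intro x; rw [← hsum, ← hprod]; ring
  have hfac' : ∀ x : ℚ_[q], x ^ 2 + t' * x + n' = (x + α) * (x + β) := by
    intro x; rw [← hsum, ← hprod]; ring
  have hpow1 : (q : ℝ) ^ (-((1 : ℕ) : ℤ)) = (q : ℝ)⁻¹ := by rw [zpow_neg, Nat.cast_one, zpow_one]
  have hpow2 : (q : ℝ) ^ (-((2 : ℕ) : ℤ)) = ((q : ℝ) ^ 2)⁻¹ := by rw [zpow_neg, zpow_natCast]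
  have hq2 : ((q : ℝ) ^ 2)⁻¹ ≤ (q : ℝ)⁻¹ := by
    rw [inv_le_inv₀ (pow_pos hq0 2) hq0]; exact le_self_pow₀ hqR.le two_ne_zero
  -- divisibility from norm estimates
  have hdvd1 : ∀ z : ℤ, ‖(z : ℚ_[q])‖ ≤ (q : ℝ)⁻¹ → (q : ℤ) ∣ z := by
    intro z hz
    have := (Padic.norm_int_le_pow_iff_dvd z 1).mp (by rwa [hpow1])
    rwa [pow_one] at this
  have hdvd2 : ∀ z : ℤ, ‖(z : ℚ_[q])‖ ≤ ((q : ℝ) ^ 2)⁻¹ → (q : ℤ) ^ 2 ∣ z := by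
    intro z hz
    exact_mod_cast (Padic.norm_int_le_pow_iff_dvd z 2).mp (by rwa [hpow2])
  by_cases hsmall : ‖s‖ ≤ (q : ℝ)⁻¹
  · -- `q`-adically a double root: `ℤ[σ]` is not maximal at `q`
    exfalso
    apply hmax
    obtain ⟨k, -, hk⟩ := exists_nat_norm_sub_le (k := -α) (by rw [norm_neg]; exact hαint) 2
    have hk' : ‖(k : ℚ_[q]) + α‖ ≤ ((q : ℝ) ^ 2)⁻¹ := by
      rw [show (k : ℚ_[q]) + α = -(-α - (k : ℚ_[q])) by ring, norm_neg, ← hpow2]; exact hk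
    refine ⟨k, hdvd1 _ ?_, hdvd2 _ ?_⟩
    · -- `t' + 2k = 2(k + α) - s`
      have e : ((t' + 2 * k : ℤ) : ℚ_[q]) = 2 * ((k : ℚ_[q]) + α) - s := by
        push_cast; rw [← hdiff, ← hsum]; ring
      rw [e]
      refine hsub ?_ hsmall
      rw [norm_mul]
      calc ‖(2 : ℚ_[q])‖ * ‖(k : ℚ_[q]) + α‖ ≤ 1 * (q : ℝ)⁻¹ :=
            mul_le_mul (hnat 2) (hk'.trans hq2) (norm_nonneg _) zero_le_one
        _ = (q : ℝ)⁻¹ := one_mul _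
    · have e : ((k ^ 2 + t' * k + n' : ℤ) : ℚ_[q]) = ((k : ℚ_[q]) + α) * ((k : ℚ_[q]) + β) := by
        push_cast; rw [← hfac']
      rw [e, norm_mul]
      calc ‖(k : ℚ_[q]) + α‖ * ‖(k : ℚ_[q]) + β‖ ≤ ((q : ℝ) ^ 2)⁻¹ * 1 :=
            mul_le_mul hk' ((Padic.nonarchimedean _ _).trans (max_le (hnat k) hβint)) (norm_nonneg _) (by positivity)
        _ = ((q : ℝ) ^ 2)⁻¹ := mul_one _
  · -- two distinct roots modulo `q`
    push Not at hsmall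
    obtain ⟨a, -, ha⟩ := exists_nat_norm_sub_le (k := α) hαint 1
    obtain ⟨b, -, hb⟩ := exists_nat_norm_sub_le (k := β) hβint 1
    rw [hpow1] at ha hb
    have hroot : ∀ {c : ℕ}, ‖(c : ℚ_[q]) - α‖ * ‖(c : ℚ_[q]) - β‖ ≤ (q : ℝ)⁻¹ →
        (q : ℤ) ∣ (c : ℤ) ^ 2 - t' * c + n' := by
      intro c hc
      apply hdvd1
      have e : (((c : ℤ) ^ 2 - t' * c + n' : ℤ) : ℚ_[q]) = ((c : ℚ_[q]) - α) * ((c : ℚ_[q]) - β) := by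
        push_cast; rw [hfac]
      rwa [e, norm_mul]
    have ha' : (q : ℤ) ∣ (a : ℤ) ^ 2 - t' * a + n' := by
      refine hroot ?_
      calc ‖(a : ℚ_[q]) - α‖ * ‖(a : ℚ_[q]) - β‖ ≤ (q : ℝ)⁻¹ * 1 :=
            mul_le_mul (by rw [← norm_neg, neg_sub]; exact ha) (hsub (hnat a) hβint) (norm_nonneg _) (by positivity)
        _ = (q : ℝ)⁻¹ := mul_one _
    have hb' : (q : ℤ) ∣ (b : ℤ) ^ 2 - t' * b + n' := by
      refine hroot ?_
      calc ‖(b : ℚ_[q]) - α‖ * ‖(b : ℚ_[q]) - β‖ ≤ 1 * (q : ℝ)⁻¹ :=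
            mul_le_mul (hsub (hnat b) hαint) (by rw [← norm_neg, neg_sub]; exact hb) (norm_nonneg _) zero_le_one
        _ = (q : ℝ)⁻¹ := one_mul _
    -- `a ≢ b (mod q)`
    have hab : a % q ≠ b % q := by
      intro hmod
      have hdvd : (q : ℤ) ∣ (a : ℤ) - b := by
        rw [Int.dvd_iff_emod_eq_zero, Int.sub_emod, show ((a : ℤ)) % q = ((a % q : ℕ) : ℤ) by simp,
          show ((b : ℤ)) % q = ((b % q : ℕ) : ℤ) by simp, hmod, sub_self, Int.zero_emod]
      have hn : ‖(((a : ℤ) - b : ℤ) : ℚ_[q])‖ ≤ (q : ℝ)⁻¹ := by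
        rw [← hpow1, Padic.norm_int_le_pow_iff_dvd, pow_one]; exact hdvd
      have : ‖s‖ ≤ (q : ℝ)⁻¹ := by
        have e : s = (α - a) + ((((a : ℤ) - b : ℤ) : ℚ_[q])) + (b - β) := by rw [← hdiff]; push_cast; ring
        rw [e]
        refine (Padic.nonarchimedean _ _).trans (max_le ((Padic.nonarchimedean _ _).trans (max_le ha hn)) ?_)
        rw [← norm_neg, neg_sub]; exact hb
      linarith
    -- count
    refine le_antisymm (rho_le_two hq.out t' n') ?_
    unfold rho
    have hsub' : ({a % q, b % q} : Finset ℕ) ⊆ (Finset.range q).filter fun x : ℕ => (q : ℤ) ∣ (x : ℤ) ^ 2 - t' * x + n' := by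
      intro x hx
      rcases Finset.mem_insert.mp hx with rfl | hx
      · exact mod_mem_filter_of_dvd ha'
      · rw [Finset.mem_singleton] at hx; rw [hx]; exact mod_mem_filter_of_dvd hb'
    calc 2 = ({a % q, b % q} : Finset ℕ).card := by rw [Finset.card_pair hab]
      _ ≤ _ := Finset.card_le_card hsub'

/-- Transport of `p`-adic squares along an equality of primes (the two `Fact` instances are
definitionally equal). [folklore] -/
theorem isSquare_padic_of_eq {m : ℕ} [Fact m.Prime] (hm : m = q) {Δ : ℚ}
    (h : IsSquare (algebraMap ℚ ℚ_[m] Δ)) : IsSquare ((Δ : ℚ) : ℚ_[q]) := by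
  subst hm
  rw [eq_ratCast] at h
  exact h

end Hensel

/-! ### Embedding `ℚ(√(t² - 4n))` into `D` -/

section Embedding

variable {M p : ℕ} (S : XiSetup M p)

/-- An element with `x² = Δ`, `Δ < 0`, has `trd x = 0` and `nrd x = -Δ`. [folklore] -/
theorem XiSetup.reducedTrace_eq_zero_of_sq {Δ : ℚ} (hΔ : Δ < 0) {x : S.D} (hx : x * x = algebraMap ℚ S.D Δ) :
    reducedTrace ℚ S.D x = 0 ∧ reducedNorm ℚ S.D x = -Δ := by
  haveI : Nontrivial S.D := nontrivial_of_isQuaternionAlgebra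
  have h := mul_self_eq_reducedTrace_mul_sub_reducedNorm ℚ S.D x
  rw [hx] at h
  -- `trd(x) x = (Δ + nrd x) 1`
  have h1 : algebraMap ℚ S.D (reducedTrace ℚ S.D x) * x = algebraMap ℚ S.D (Δ + reducedNorm ℚ S.D x) := by
    rw [map_add, h]; abel
  by_cases htr : reducedTrace ℚ S.D x = 0
  · refine ⟨htr, ?_⟩
    rw [htr, map_zero, zero_mul, eq_comm, map_eq_zero_iff _ (algebraMap ℚ S.D).injective] at h1
    linarith
  · exfalso
    -- then `x` is a scalar `c` with `c² = Δ < 0`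
    have hxc : x = algebraMap ℚ S.D ((reducedTrace ℚ S.D x)⁻¹ * (Δ + reducedNorm ℚ S.D x)) := by
      rw [map_mul, ← h1, ← mul_assoc, ← map_mul, inv_mul_cancel₀ htr, map_one, one_mul]
    set c := (reducedTrace ℚ S.D x)⁻¹ * (Δ + reducedNorm ℚ S.D x)
    have : c * c = Δ := by
      have e := hx
      rw [hxc, ← map_mul] at e
      exact (algebraMap ℚ S.D).injective e
    nlinarith [mul_self_nonneg c]

/-- From `x² = t² - 4n` to an element of trace `t` and norm `n`: `y = (t + x)/2`. [folklore] -/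
theorem XiSetup.exists_trace_norm_of_sq {t : ℤ} {n : ℕ} (h : t ^ 2 < 4 * n) {x : S.D}
    (hx : x * x = algebraMap ℚ S.D ((t : ℚ) ^ 2 - 4 * n)) :
    ∃ y : S.D, reducedTrace ℚ S.D y = t ∧ reducedNorm ℚ S.D y = n := by
  have hΔ : ((t : ℚ)) ^ 2 - 4 * n < 0 := by exact_mod_cast (by linarith : (t ^ 2 - 4 * n : ℤ) < 0)
  obtain ⟨htr, hnr⟩ := S.reducedTrace_eq_zero_of_sq hΔ hx
  refine ⟨algebraMap ℚ S.D ((t : ℚ) / 2) + (1 / 2 : ℚ) • x, ?_, ?_⟩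
  · rw [reducedTrace_ratCoords, htr]; ring
  · rw [reducedNorm_ratCoords, htr, hnr]; ring

/-- **Vignéras III.3.8 for a Brandt setup of level `(M, p)`**: if `t² - 4n < 0` is not a square
in `ℚ_p` then some element of `D` has reduced trace `t` and reduced norm `n`. [cite: VignerasLNM800, Ch. III §3 Thm. 3.8] -/
theorem XiSetup.exists_trace_norm_of_not_isSquare [hp : Fact p.Prime] {t : ℤ} {n : ℕ} (h : t ^ 2 < 4 * n)
    (hns : ¬ IsSquare ((((t : ℚ) ^ 2 - 4 * n : ℚ)) : ℚ_[p])) :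
    ∃ y : S.D, reducedTrace ℚ S.D y = t ∧ reducedNorm ℚ S.D y = n := by
  have hΔ : ((t : ℚ)) ^ 2 - 4 * n < 0 := by exact_mod_cast (by linarith : (t ^ 2 - 4 * n : ℤ) < 0)
  set Δ : ℚ := (t : ℚ) ^ 2 - 4 * n with hΔdef
  have h1 : ¬ IsSquare Δ := by
    rintro ⟨u, hu⟩; nlinarith [mul_self_nonneg u]
  have h2 : ∀ v ∈ ramifiedPlaces ℚ S.D, ¬ IsSquare (algebraMap ℚ (v.adicCompletion ℚ) Δ) := by
    intro v hv hsqv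
    rw [S.ramifiedPlaces_eq, Set.mem_setOf_eq] at hv
    have hvp : ((Rat.HeightOneSpectrum.primesEquiv v : Nat.Primes) : ℕ) = p :=
      (Nat.prime_dvd_prime_iff_eq (Rat.HeightOneSpectrum.primesEquiv v).2 hp.out).mp hv
    -- transport to `ℚ_[p_v]` and then to `ℚ_[p]`
    haveI : Fact (Nat.Prime ((Rat.HeightOneSpectrum.primesEquiv v : Nat.Primes) : ℕ)) :=
      ⟨(Rat.HeightOneSpectrum.primesEquiv v).2⟩
    let e := Rat.HeightOneSpectrum.adicCompletion.padicEquiv (R := 𝓞 ℚ) v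
    have hsq' : IsSquare (algebraMap ℚ ℚ_[((Rat.HeightOneSpectrum.primesEquiv v : Nat.Primes) : ℕ)] Δ) := by
      have := hsqv.map e.toAlgEquiv
      rwa [AlgEquiv.commutes] at this
    exact hns (isSquare_padic_of_eq hvp hsq')
  have h3 : ∀ w ∈ ramifiedInfinitePlaces ℚ S.D, ¬ IsSquare (algebraMap ℚ w.Completion Δ) := by
    intro w _ hsqw
    have hw : w.IsReal := NumberField.IsTotallyReal.isReal w
    let ψ := NumberField.InfinitePlace.Completion.extensionEmbeddingOfIsReal hw
    have := hsqw.map ψ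
    rw [show ψ (algebraMap ℚ w.Completion Δ) = (Δ : ℝ) from eq_ratCast (ψ.comp (algebraMap ℚ w.Completion)) Δ] at this
    obtain ⟨u, hu⟩ := this
    have : (Δ : ℝ) < 0 := by exact_mod_cast hΔ
    nlinarith [mul_self_nonneg u]
  obtain ⟨x, hx⟩ := exists_sq_eq_of_not_isSquare_ramified_holds ℚ S.D Δ h1 h2 h3
  exact S.exists_trace_norm_of_sq h hx

/-- **If `ℚ[X]/(X² - tX + n)` does not embed in `D` then `m_p(f) = 0` for every conductor `f`.** [cite: VignerasLNM800, Ch. III §3 Thm. 3.8, Ch. II §3] -/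
theorem XiSetup.brFactorRam_eq_zero_of_forall (hp : p.Prime) {t : ℤ} {n : ℕ} (h : t ^ 2 < 4 * n)
    (hno : ∀ x : S.D, reducedTrace ℚ S.D x = t → reducedNorm ℚ S.D x ≠ n) {f : ℕ}
    (hf : f ∈ ellipticConductors t n) : brFactorRam p t n f = 0 := by
  haveI := Fact.mk hp
  unfold brFactorRam
  split_ifs with hfp
  · rfl
  · -- `B_f` is maximal at `p`; if `ρ_p ≠ 2`, `Δ` is not a `p`-adic square and `K ↪ D`
    suffices hρ : rho p (tOf t n f) (nOf t n f) = 2 by rw [hρ]; norm_num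
    apply rho_eq_two_of_isSquare_padic
    · rwa [nonmax_iff h hp hf]
    · by_contra hns
      obtain ⟨y, hy1, hy2⟩ := S.exists_trace_norm_of_not_isSquare h (by
        intro hsq
        apply hns
        -- `Δ = f² Δ_f`
        have hf0 : (f : ℚ_[p]) ≠ 0 := by exact_mod_cast (pos_of_mem_ellipticConductors h hf).ne'
        have e : (((tOf t n f ^ 2 - 4 * nOf t n f : ℤ)) : ℚ_[p]) =
            ((f : ℚ_[p]))⁻¹ ^ 2 * ((((t : ℚ) ^ 2 - 4 * n : ℚ)) : ℚ_[p]) := by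
          have := sq_mul_disc h hf
          have e' : (((t ^ 2 - 4 * n : ℤ)) : ℚ_[p]) = ((f : ℚ_[p])) ^ 2 * (((tOf t n f ^ 2 - 4 * nOf t n f : ℤ)) : ℚ_[p]) := by
            rw [← this]; push_cast; ring
          push_cast at e' ⊢
          rw [e']; field_simp
        rw [e]
        exact (IsSquare.sq _).mul hsq)
      exact hno y hy1 hy2

/-- **The elliptic terms at a non-embeddable `(t, n)` vanish termwise in `m_p`:**
`Σ_f h_w (∏_{q ∈ P} m_q(f)) m_p(f) = 0`. [cite: VignerasLNM800, Ch. III §3 Thm. 3.8, Ch. II §3] -/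
theorem XiSetup.sum_hw_br_eq_zero_of_forall (hp : p.Prime) {t : ℤ} {n : ℕ} (h : t ^ 2 < 4 * n)
    (hno : ∀ x : S.D, reducedTrace ℚ S.D x = t → reducedNorm ℚ S.D x ≠ n) (P : Finset ℕ) :
    ∑ f ∈ ellipticConductors t n, hw t n f * ((∏ q ∈ P, brFactor q t n f) * brFactorRam p t n f) = 0 := by
  refine Finset.sum_eq_zero fun f hf => ?_
  rw [S.brFactorRam_eq_zero_of_forall hp h hno hf, mul_zero, mul_zero]

end Embedding

end Brandt

end Literature.NumberTheory.Automorphic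

end
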